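/-
Copyright (c) 2026 the pub-hodgecm-mathlib formalisation cell (harness21).  Prover seat hodgecm-mathlib-K2E3-p34 (g2), Track B «K2-LIT», engine E3, unit U4 «Keys»; PART
«U4Keys» socket :182 (U4f-χ₁-ram-one-pos), programme A_pos^{=} (memo `K2/K2E3-p37/g0/CENSUS-U4f-PosDepth.K2E3-p37-g0.md` §10 (c)), brick (c2) «THE TORUS WITNESS AT LEVEL `J_n`»;
dealer K2E3-plan (g5), K2 bus 2026-09-04T16:44Z.  KERNEL module: THEOREMS ONLY (no definition, no named fact, no `sorry`, no instance, no notation).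
-/
import Summits.HodgeConjecture.HodgeConjecture.Theorems.K2E3BranchATorusWitnessCM          -- ★ Z2A-3c (ii) (K2E3-p06 g4): the depth-zero twin `exists_torusWitness` (`b₀ ∈ I`), `exists_torus_mem_inf`, `w₀_mem_K0`, `twist_comp_proj_apply_one`; brings the (G3) frame, ★ `symm_mem_of_mem_inf`, ★ `coe_eA_apply`
import Summits.HodgeConjecture.HodgeConjecture.Theorems.K2E3IwahoriLevelNFactorisation      -- ★ p861548 (K2E3-p37 g0): `mem_glInt_inf_conj_glInt_pow_of_diagonal` (integral diagonal elements lie in the model `J_n`)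
import HarnessLib

/-!
# K2 ∕ E3 «EllipticInputs», unit U4 «Keys» — socket :182 (positive depth), programme A_pos, brick (c2): THE TORUS WITNESS OF BRANCH A AT LEVEL `J_n`
# «`b₀ = d(u, 1, ū⁻¹) ∈ J_n` and `θ(b₀) = χ₁(u) ≠ χ₁(ū⁻¹) = (χδ^{1∕2})(w₀ b₀ w₀⁻¹)`» on `U(Φ₃)(L⁺_v)`, `v` non-split
# [Keys1984 §3, §7 Thm (2); Roche1998 §3–§4; Rogawski1990 §12.1]

Cell hodgecm-mathlib, Track B «K2-LIT», engine E3, crux item H413 = `stmt-HodgeConjecture-24833` (route `HCCMUnconditional`); line `K2_E3_EllipticInputs`, PART «U4Keys»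
socket :182 `sig_K2E3KeysThmTwoContractingRamifiedCharOnePosDepth` (Branch A at POSITIVE depth, programme A_pos^{=} of K2E3-p37 (g0)'s memo §6–§10).
`--supports stmt-HodgeConjecture-24833 --as helper`; THEOREMS ONLY; NOT THE PAYER (one input of the (c3) assembly `not_reducible_of_posDepth_of_normChar_ne_one_eq`).

THE POINT.  The cell-family engine ★ `K2E3BranchAContradictionCells.false_of_typeVector_of_integral_eq_zero_of_cells` (p861573) is run at positive depth with the
level-`n` Iwahori `B := J_n = K₀ ⊓ eA⁻¹(g_nK₀g_n⁻¹ ∩ U_w)` (letter `hJn` of ★ `K2E3IwahoriLevelNLettersCM`, `g_n = diag(1,1,ϖⁿ)`) in place of `I = J_1`.  Its witness clause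
`hwit` at the representative `r = w₀` (the BIG CELL `|z| ≥ 1`, ★ p861613) asks for `b₀ ∈ J_n` — not merely `b₀ ∈ I` as the depth-zero letter ★ `exists_torusWitness` records —
with `w₀ b₀ w₀⁻¹ ∈ P` and `θ(b₀) ≠ ((χ∘proj) ⊗ δ^{1∕2})(w₀ b₀ w₀⁻¹)·1`.  The depth-zero witness `b₀ = d(u_w, 1, (σu_w)⁻¹)` (an INTEGRAL DIAGONAL element) lies in `J_n` for EVERY
`n` (★ `mem_glInt_inf_conj_glInt_pow_of_diagonal`: the strictly-lower entries of a diagonal matrix are `0`), and the disagreement `χ₁(u) ≠ χ₁((σu)⁻¹)` is the depth-zero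
computation verbatim (it only uses `χ₁(u·σu) ≠ 1`).  Since ★ `exists_torusWitness` hides its `b₀` behind `∃`, the proof is REPLAYED here with the extra membership recorded:
* §1 `exists_torus_mem_levelN` — `∃ b₀ ∈ J_n`, `b₀ ∈ I`, `b₀ ∈ T(L⁺_v)`, `(b₀)₀₀ = u` (twin of ★ `exists_torus_mem_inf`);
* §2 **`exists_torusWitness_levelN`** — ★ `exists_torusWitness`'s statement with the extra conjunct `b₀ ∈ Jn` (letters `gn hgn Jn hJn` of ★ p861811 VERBATIM; no `1 ≤ n` needed).
HONEST LABEL: HC_CM is proved only modulo the 7 printed citations (2 remaining named inputs: hLiu418 = stmt-HodgeConjecture-24832, h413 = stmt-HodgeConjecture-24833) until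
rung 0 closes; count-neutral — this file does NOT pay the leaf; :182 stays OPEN (A_pos^{=} needs (c1) big-cell CM dress, (b) the CM dress of the depth witnesses, (c3) the assembly).

## References
* [Keys1984] D. Keys, *Principal series representations of special unitary groups over local fields*, Compositio Math. 51 (1984), §3, §7 Thm (2).
* [Roche1998] A. Roche, *Types and Hecke algebras for principal series representations of split reductive p-adic groups*, Ann. Sci. ÉNS (4) 31 (1998), §3–§4.
* [Rogawski1990] J. D. Rogawski, *Automorphic Representations of Unitary Groups in Three Variables*, Ann. of Math. Stud. 123 (1990), §12.1 p. 171, §1.10 p. 9.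
* [BruhatTits1972] F. Bruhat, J. Tits, Publ. Math. IHÉS 41 (1972), (4.4.3)–(4.4.4).
-/

set_option autoImplicit false
-- the mandated namespace has the single-problem summit's repeated segment (`HodgeConjecture.HodgeConjecture`)
set_option linter.dupNamespace false

noncomputable section

open NumberField IsDedekindDomain
open scoped Matrix MatrixGroups WithZero Valued
open Literature.NumberTheory Literature.NumberTheory.Automorphic Literature.NumberTheory.Automorphic.UnitaryGroup
open Literature.NumberTheory.Rogawski1990

namespace Summit.HodgeConjecture.HodgeConjecture.Cruxes.H413.K2E3BranchATorusWitnessLevelN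

open Summit.HodgeConjecture.HodgeConjecture.Cruxes.H413
open Summit.HodgeConjecture.HodgeConjecture.Cruxes.H413.K2E3DepthZeroIwahoriCharacterCM
open Summit.HodgeConjecture.HodgeConjecture.Cruxes.H413.K2E3BranchALettersCM
open Summit.HodgeConjecture.HodgeConjecture.Cruxes.H413.K2E3BranchATorusWitnessCM

variable (L : Type) [Field L] [NumberField L] [IsCMField L] (v : HeightOneSpectrum (𝓞 ↥(maximalRealSubfield L)))
  (w : PlacesOver L v) (hw : IsCMField.complexConj L • w.1 = w.1)
  (eA : Gqs L v ≃ₜ* ↥(unitaryGroupOfForm (galAdicCompletionMap (L := L) (IsCMField.complexConj L) hw) ((StdForm.antidiagonal 3).over (w.1.adicCompletion L))))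
  (heA : ∀ g : Gqs L v,
    ((eA g : ↥(unitaryGroupOfForm (galAdicCompletionMap (L := L) (IsCMField.complexConj L) hw) ((StdForm.antidiagonal 3).over (w.1.adicCompletion L)))) :
        GL (Fin 3) (w.1.adicCompletion L)) =
      ((localNonsplitEquiv (IsCMField.complexConj L) (qsForm L) (IsCMField.complexConj_ne_one L) w hw g :
        ↥(unitaryGroupOfForm (galAdicCompletionMap (L := L) (IsCMField.complexConj L) hw) (placeForm (qsForm L) w.1))) : GL (Fin 3) (w.1.adicCompletion L)))
  {ϖ : w.1.adicCompletion L} (hϖ : Valued.v ϖ = WithZero.exp (-1 : ℤ))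
  (g₁ : GL (Fin 3) (w.1.adicCompletion L)) (hg₁ : (g₁ : Matrix (Fin 3) (Fin 3) (w.1.adicCompletion L)) = Matrix.diagonal ![(1 : w.1.adicCompletion L), 1, ϖ])
  (K0 K1 I : Subgroup (Gqs L v))
  (hK0 : K0 = ((glInt 3 (w.1.adicCompletion L)).subgroupOf
    (unitaryGroupOfForm (galAdicCompletionMap (L := L) (IsCMField.complexConj L) hw) ((StdForm.antidiagonal 3).over (w.1.adicCompletion L)))).comap
      eA.toMulEquiv.toMonoidHom)
  (hK1 : K1 = (((glInt 3 (w.1.adicCompletion L)).map (MulAut.conj g₁).toMonoidHom).subgroupOf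
    (unitaryGroupOfForm (galAdicCompletionMap (L := L) (IsCMField.complexConj L) hw) ((StdForm.antidiagonal 3).over (w.1.adicCompletion L)))).comap
      eA.toMulEquiv.toMonoidHom)
  (hI : I = K0 ⊓ K1)
  {n : ℕ} (gn : GL (Fin 3) (w.1.adicCompletion L))
  (hgn : (gn : Matrix (Fin 3) (Fin 3) (w.1.adicCompletion L)) = Matrix.diagonal ![(1 : w.1.adicCompletion L), 1, ϖ ^ n])
  (Jn : Subgroup (Gqs L v))
  (hJn : Jn = K0 ⊓ (((glInt 3 (w.1.adicCompletion L)).map (MulAut.conj gn).toMonoidHom).subgroupOf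
    (unitaryGroupOfForm (galAdicCompletionMap (L := L) (IsCMField.complexConj L) hw) ((StdForm.antidiagonal 3).over (w.1.adicCompletion L)))).comap
      eA.toMulEquiv.toMonoidHom)
  (w₀ : Gqs L v) (hw₀ : Units.val (w₀.val : GL (Fin 3) (LocalRing L v)) = cmLocalForm L 3 v)

/-! ## §1 The torus element `b₀ = d(u_w, 1, (σu_w)⁻¹)` lies in `J_n` (every `n`) -/

include hw heA hϖ hg₁ hK0 hK1 hI hgn hJn in
set_option maxHeartbeats 1600000 in
-- the `Gqs L v` ∕ matrix-subgroup carriers are definitionally equal but unify slowly (class of ★ `exists_torus_mem_inf`)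
/-- **`b₀ = d(u_w, 1, (σu_w)⁻¹) ∈ J_n`**: for a unit `u` of `L ⊗ L⁺_v` with `|u_{w′}| = 1` there is `b₀` in the level-`n` Iwahori `J_n` (letter `hJn`), in `I`, in the diagonal
torus `T(L⁺_v)`, with `(b₀)₀₀ = u` — ★ `exists_torus_mem_inf` with the extra membership `b₀ ∈ J_n`, which holds for every `n` because an integral DIAGONAL unitary passes the
level-`n` test (★ `K2E3IwahoriLevelNFactorisation.mem_glInt_inf_conj_glInt_pow_of_diagonal`). [cite: Rogawski1990, §1.10 p. 9] [cite: BruhatTits1972, (4.4.3)–(4.4.4)] [cite: Roche1998, §3] -/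
theorem exists_torus_mem_levelN (u : (LocalRing L v)ˣ) (hu : ∀ w' : PlacesOver L v, Valued.v ((u : LocalRing L v) w') = 1) :
    ∃ b₀ : Gqs L v, b₀ ∈ Jn ∧ b₀ ∈ I ∧
      (b₀ : ↥(unitaryGroupOfForm (conjLocal L (IsCMField.complexConj L) v) (cmLocalForm L 3 v))) ∈ (cmBorelTriple L 3 v).M ∧
      ((b₀.val : GL (Fin 3) (LocalRing L v)) : Matrix (Fin 3) (Fin 3) (LocalRing L v)) 0 0 = (u : LocalRing L v) := by
  have hσσ : ∀ x, (galAdicCompletionMap (L := L) (IsCMField.complexConj L) hw) ((galAdicCompletionMap (L := L) (IsCMField.complexConj L) hw) x) = x :=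
    galAdicCompletionMap_galAdicCompletionMap_of_smul_eq (IsCMField.complexConj L) w (IsCMField.complexConj_ne_one L) hw
  have hvσ : ∀ x, Valued.v (galAdicCompletionMap (L := L) (IsCMField.complexConj L) hw x) = Valued.v x :=
    fun x => valued_galAdicCompletionMap (L := L) (IsCMField.complexConj L) hw x
  have hα : Valued.v ((u : LocalRing L v) w) = 1 := hu w
  have hα0 : (u : LocalRing L v) w ≠ 0 := fun h => by rw [h, map_zero] at hα; exact zero_ne_one hα
  obtain ⟨s, hsT, hs⟩ := exists_coe_eq_diag (galAdicCompletionMap (L := L) (IsCMField.complexConj L) hw)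
    (rfl : (StdForm.antidiagonal 3).over (w.1.adicCompletion L) = _) hσσ hα0 (β := 1) (by rw [map_one, mul_one])
  -- `s ∈ K₀` (model)
  have hsK0 : s ∈ (glInt 3 (w.1.adicCompletion L)).subgroupOf
      (unitaryGroupOfForm (galAdicCompletionMap (L := L) (IsCMField.complexConj L) hw) ((StdForm.antidiagonal 3).over (w.1.adicCompletion L))) := by
    rw [mem_glInt_subgroupOf_iff _ rfl hvσ, hs]
    intro i j
    fin_cases i <;> fin_cases j <;> simp [hvσ, hα]
  -- `s ∈ I_w` (model, level `1`)
  have hsI := mem_glInt_inf_conj_glInt_of_v_lt_one _ rfl hvσ hϖ g₁ hg₁ hsK0 (by rw [hs]; simp)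
  -- `s ∈ J_n` (model, level `n`): `s` is an integral DIAGONAL element
  have hsd : ((s : GL (Fin 3) (w.1.adicCompletion L)) : Matrix (Fin 3) (Fin 3) (w.1.adicCompletion L)) =
      Matrix.diagonal ![(u : LocalRing L v) w, 1, ((galAdicCompletionMap (L := L) (IsCMField.complexConj L) hw) ((u : LocalRing L v) w))⁻¹] := by
    rw [hs]
    ext i j
    fin_cases i <;> fin_cases j <;> simp [Matrix.diagonal]
  have hsJ := K2E3IwahoriLevelNFactorisation.mem_glInt_inf_conj_glInt_pow_of_diagonal (galAdicCompletionMap (L := L) (IsCMField.complexConj L) hw)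
    (rfl : (StdForm.antidiagonal 3).over (w.1.adicCompletion L) = _) hvσ hϖ gn hgn hsK0 hsd
  refine ⟨eA.symm s, ?_, symm_mem_of_mem_inf L v w hw eA g₁ K0 K1 I hK0 hK1 hI hsI, ?_, ?_⟩
  · -- `eA⁻¹ s ∈ Jn = K0 ⊓ eA⁻¹(g_nK₀g_n⁻¹ ∩ U_w)` (the idiom of ★ `symm_mem_of_mem_inf`)
    subst hJn hK0
    obtain ⟨h1, h2⟩ := Subgroup.mem_inf.1 hsJ
    rw [← eA.apply_symm_apply s] at h1 h2
    exact Subgroup.mem_inf.2 ⟨h1, h2⟩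
  · exact (K2E3IwahoriDetection.eA_mem_torusU_iff L v w hw eA heA (eA.symm s)).1 (by rw [ContinuousMulEquiv.apply_symm_apply]; exact hsT)
  · rw [LocalRing.eq_iff_apply_eq (IsCMField.complexConj L) (IsCMField.complexConj_ne_one L) w hw, ← coe_eA_apply L v w hw eA heA (eA.symm s) 0 0,
      ContinuousMulEquiv.apply_symm_apply, hs]
    rfl

/-! ## §2 The level-`n` torus witness: `b₀ ∈ J_n`, `w₀ b₀ w₀⁻¹ ∈ P`, `θ(b₀) ≠ (χδ^{1∕2})(w₀ b₀ w₀⁻¹)` -/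

open Classical in
include hw heA hϖ hg₁ hK0 hK1 hI hgn hJn hw₀ in
set_option maxHeartbeats 1600000 in
-- the `U(Φ₃)(L⁺_v)`-valued products are read in two definitionally equal carriers (`Gqs L v` and the matrix subgroup); unification is slow (class of ★ `exists_torusWitness`)
/-- **THE WITNESS CLAUSE `hwit` OF THE CELL-FAMILY ENGINE AT THE REPRESENTATIVE `w₀`, LEVEL `J_n`.**  For `χ₁ : (L ⊗ L⁺_v)ˣ → ℂˣ` and a unit `u` with `|u_{w′}| = 1` and
`χ₁(u · σu) ≠ 1` (Branch A), the element `b₀ = d(u, 1, (σu)⁻¹)` (§1) lies in the level-`n` Iwahori `J_n` (AND in `I`), its `w₀`-conjugate lies in `P`, and the Iwahori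
character `θ(b₀) = χ₁((b₀)₀₀) = χ₁(u)` differs from `((χ∘proj) ⊗ δ^{1∕2})(w₀ b₀ w₀⁻¹)·1 = χ₁((σu)⁻¹)` (`δ^{1∕2} = 1` on the compact `K₀ ∋ w₀ b₀ w₀⁻¹`; ★ `torusEntry_zero_weylConj`).
This is ★ `K2E3BranchATorusWitnessCM.exists_torusWitness` with `I ↦ J_n` (its proof replayed; the depth of `χ₁` plays no role: the witness is a UNIT, not a principal unit).
[cite: Keys1984, §3, §7 Thm (2)] [cite: Roche1998, §3–§4] [cite: Rogawski1990, §12.1 p. 171] -/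
theorem exists_torusWitness_levelN (χ₁ : (LocalRing L v)ˣ →* ℂˣ) (u : (LocalRing L v)ˣ) (hu : ∀ w' : PlacesOver L v, Valued.v ((u : LocalRing L v) w') = 1)
    (hA : χ₁ (u * Units.map (conjLocal L (IsCMField.complexConj L) v : LocalRing L v →* LocalRing L v) u) ≠ 1) :
    ∃ (b₀ : Gqs L v) (hb₀P : ((w₀ * b₀ * w₀⁻¹ : Gqs L v) : ↥(unitaryGroupOfForm (conjLocal L (IsCMField.complexConj L) v) (cmLocalForm L 3 v))) ∈ (cmBorelTriple L 3 v).P),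
      b₀ ∈ Jn ∧ b₀ ∈ I ∧
      (if h : IsUnit (((b₀.val : GL (Fin 3) (LocalRing L v)) : Matrix (Fin 3) (Fin 3) (LocalRing L v)) 0 0) then ((χ₁ h.unit : ℂˣ) : ℂ) else 0) ≠
        (haveI := locallyCompactSpace_cmBorelU L 3 v
         (Representation.twist
            (((Representation.trivial ℂ ↥(torusU (conjLocal L (IsCMField.complexConj L) v) (cmLocalForm L 3 v)) ℂ).twist
              (cmTorusCharPair L v χ₁ 1)).comp (cmBorelTriple L 3 v).proj) (rootDeltaChar (cmBorelTriple L 3 v).P))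
          ⟨((w₀ * b₀ * w₀⁻¹ : Gqs L v) : ↥(unitaryGroupOfForm (conjLocal L (IsCMField.complexConj L) v) (cmLocalForm L 3 v))), hb₀P⟩ 1) := by
  haveI := locallyCompactSpace_cmBorelU L 3 v
  obtain ⟨b₀, hb₀J, hb₀I, hb₀M, hb₀00⟩ := exists_torus_mem_levelN L v w hw eA heA hϖ g₁ hg₁ K0 K1 I hK0 hK1 hI gn hgn Jn hJn u hu
  have hJ : cmLocalForm L 3 v = (StdForm.antidiagonal 3).over (LocalRing L v) := cmLocalForm_eq_over L 3 v
  -- the torus element read in the matrix carrier, its `w₀`-conjugate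
  have hconjT : ((w₀ * b₀ * w₀⁻¹ : Gqs L v) : ↥(unitaryGroupOfForm (conjLocal L (IsCMField.complexConj L) v) (cmLocalForm L 3 v))) ∈ torusU (conjLocal L (IsCMField.complexConj L) v) (cmLocalForm L 3 v) :=
    weylConj_mem_torusU (conjLocal L (IsCMField.complexConj L) v) hJ w₀ hw₀
      (⟨b₀, hb₀M⟩ : ↥(torusU (conjLocal L (IsCMField.complexConj L) v) (cmLocalForm L 3 v)))
  have hb₀P : ((w₀ * b₀ * w₀⁻¹ : Gqs L v) : ↥(unitaryGroupOfForm (conjLocal L (IsCMField.complexConj L) v) (cmLocalForm L 3 v))) ∈ (cmBorelTriple L 3 v).P :=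
    torusU_le_borelU (conjLocal L (IsCMField.complexConj L) v) (cmLocalForm L 3 v) hconjT
  refine ⟨b₀, hb₀P, hb₀J, hb₀I, ?_⟩
  -- left-hand side: `θ(b₀) = χ₁(u)`
  have hU : IsUnit (((b₀.val : GL (Fin 3) (LocalRing L v)) : Matrix (Fin 3) (Fin 3) (LocalRing L v)) 0 0) := by rw [hb₀00]; exact Units.isUnit u
  have hunit : hU.unit = u := Units.ext (by rw [IsUnit.unit_spec, hb₀00])
  rw [dif_pos hU, hunit]
  -- right-hand side: `δ^{1/2}(w₀ b₀ w₀⁻¹) · χ₁(torusEntry 0 (proj (w₀ b₀ w₀⁻¹)))`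
  rw [twist_comp_proj_apply_one (cmBorelTriple L 3 v) (cmTorusCharPair L v χ₁ 1) (rootDeltaChar (cmBorelTriple L 3 v).P) ⟨_, hb₀P⟩]
  -- `δ^{1/2} = 1` on the compact `K₀`
  have hlev := F0P3cStCharTSStLevelsTransport.isOpen_isCompact_levels L v w hw eA g₁ K0 K1 I hK0 hK1 hI
  have hw0K : w₀ ∈ K0 := w₀_mem_K0 L v w hw eA heA K0 hK0 w₀ hw₀
  have hb0K : b₀ ∈ K0 := by rw [hI] at hb₀I; exact (Subgroup.mem_inf.1 hb₀I).1
  have hxK : w₀ * b₀ * w₀⁻¹ ∈ K0 := Subgroup.mul_mem _ (Subgroup.mul_mem _ hw0K hb0K) (Subgroup.inv_mem _ hw0K)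
  have hδ : rootDeltaChar (cmBorelTriple L 3 v).P ⟨_, hb₀P⟩ = 1 :=
    rootDeltaChar_eq_one_of_mem_of_isClosed_of_isCompact (cmBorelTriple L 3 v).P
      (isClosed_borelU (conjLocal L (IsCMField.complexConj L) v) (cmLocalForm L 3 v)) (K := K0) hlev.1.2 hxK
  rw [hδ, Units.val_one, one_mul]
  -- the `χ`-value at the conjugated torus element: `χ₁((σu)⁻¹)`
  have hproj : (cmBorelTriple L 3 v).proj ⟨_, hb₀P⟩ = ⟨((w₀ * b₀ * w₀⁻¹ : Gqs L v) : ↥(unitaryGroupOfForm (conjLocal L (IsCMField.complexConj L) v) (cmLocalForm L 3 v))), hconjT⟩ :=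
    proj_weylConj (conjLocal L (IsCMField.complexConj L) v) hJ w₀ hw₀
      (⟨b₀, hb₀M⟩ : ↥(torusU (conjLocal L (IsCMField.complexConj L) v) (cmLocalForm L 3 v)))
  have hentry : torusEntry (conjLocal L (IsCMField.complexConj L) v) (cmLocalForm L 3 v) 0 ⟨((w₀ * b₀ * w₀⁻¹ : Gqs L v) : ↥(unitaryGroupOfForm (conjLocal L (IsCMField.complexConj L) v) (cmLocalForm L 3 v))), hconjT⟩ =
      (Units.map (conjLocal L (IsCMField.complexConj L) v : LocalRing L v →* LocalRing L v) u)⁻¹ := by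
    have h := torusEntry_zero_weylConj (conjLocal L (IsCMField.complexConj L) v) hJ w₀ hw₀
      (⟨b₀, hb₀M⟩ : ↥(torusU (conjLocal L (IsCMField.complexConj L) v) (cmLocalForm L 3 v)))
    have hT0 : torusEntry (conjLocal L (IsCMField.complexConj L) v) (cmLocalForm L 3 v) 0
        (⟨b₀, hb₀M⟩ : ↥(torusU (conjLocal L (IsCMField.complexConj L) v) (cmLocalForm L 3 v))) = u :=
      Units.ext (by rw [coe_torusEntry]; exact hb₀00)
    rw [hT0] at h
    exact h
  rw [show cmTorusCharPair L v χ₁ 1 = torusCharPair (conjLocal L (IsCMField.complexConj L) v) (cmLocalForm L 3 v) hJ 0 χ₁ 1 from rfl,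
    torusCharPair_apply, MonoidHom.one_apply, mul_one, hproj, hentry]
  -- `χ₁(u) ≠ χ₁((σu)⁻¹)` from `χ₁(u · σu) ≠ 1`
  intro heq
  apply hA
  have h1 : χ₁ u = χ₁ (Units.map (conjLocal L (IsCMField.complexConj L) v : LocalRing L v →* LocalRing L v) u)⁻¹ := Units.ext heq
  rw [map_mul, h1, map_inv, inv_mul_cancel]

end Summit.HodgeConjecture.HodgeConjecture.Cruxes.H413.K2E3BranchATorusWitnessLevelN

end
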